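import Literature.Geometry.Lorentzian.KerrSchildMultiplierCurrent
import Literature.Geometry.Lorentzian.KerrSchildGraphDivergence
import HarnessLib

/-!
# The energy identity of a vector-field multiplier on slabs and between graph hypersurfaces
# (Dafermos–Rodnianski–Shlapentokh-Rothman, §2.3.2, (ingeneralform)) in the Kerr–Schild chart

(family `gr`; infrastructure for the physical-space multiplier estimates behind statement
**gr.S24**; namespace `Literature.Geometry.Lorentzian.KerrSchild`)

Dafermos–Rodnianski–Shlapentokh-Rothman (arXiv:1402.7034 = Ann. of Math. 183 (2016)), §2.3.2:
"The divergence identity between two homologous spacelike hypersurfaces `S⁻`, `S⁺`, bounding a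
region `𝓑`, with `S⁺` in the future of `S⁻`, yields
`∫_{S⁺} J^V_μ[Ψ] n^μ_{S⁺} + ∫_𝓑 (K^V[Ψ] + 𝓔^V[Ψ]) = ∫_{S⁻} J^V_μ[Ψ] n^μ_{S⁻}` … We shall
typically apply [it] … where `Ψ` is compactly supported." This file assembles that identity, in
the ingoing Kerr–Schild chart (`det g = −1`, `dVol = dt dy`), for the divergence-form wave
operator `□_G = ∂_μ G^{μν} ∂_ν` of a `C¹` symmetric coefficient field `G`
(`KerrSchild.waveOperator`), an arbitrary `C¹` vector-field multiplier `X` and a `C²` function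
`w`, from

* the pointwise identity `∑_μ ∂_μ (J^X)^μ = (□_G w) X(w) + K^X`
  (`KerrSchild.sum_fderiv_multiplierCurrent`, `KerrSchildMultiplierCurrent.lean`), and
* the integrated divergence identities for `C¹` currents on slabs and between graphs
  (`E4.integral_sub_eq_integral_divergence`, `E4.graphFlux_sub_eq_integral_integral`,
  `KerrSchildSlabDivergence.lean`, `KerrSchildGraphDivergence.lean`):

* `KerrSchild.contDiff_multiplierCurrent`, `KerrSchild.contDiff_lagrangianCurrent` — the currents
  of `C¹` data `G, X` (`ϖ ∈ C²`) and `w ∈ C²` are `C¹`;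
* `KerrSchild.multiplierCurrent_slab_identity` — for `dw = 0` on the far part `{‖y‖ > ρ}` of the
  closed slab `[t₀, t₁] × E3`:
  `∫ (J^X)⁰(t₁, y) dy − ∫ (J^X)⁰(t₀, y) dy = ∫_{(t₀,t₁]} ∫ ((□_G w) X(w) + K^X)(t, y) dy dt`;
* `KerrSchild.multiplierCurrent_graph_identity` — for `dw = 0` on the far part of the closed
  wedge between the graphs of `τ + F₁ ≤ τ + F₂` (`C²` heights):
  `∫ ∑_μ (J^X)^μ n^{F₂}_μ (τ + F₂(y), y) dy − ∫ ∑_μ (J^X)^μ n^{F₁}_μ (τ + F₁(y), y) dy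
     = ∫ ∫_{(τ + F₁(y), τ + F₂(y)]} ((□_G w) X(w) + K^X)(t, y) dt dy`, `n^F = dt − dF`;
* `KerrSchild.modifiedCurrent_graph_identity` — the same for the modified current
  `J^X + ¼ L` (`L = KerrSchild.lagrangianCurrent G ϖ w`, i.e. DRSR's `J^{X,ϖ}`), with bulk
  `(X(w) + ¼ ϖ w) □_G w + K^X + ¼ ϖ Q − ⅛ (□_G ϖ) w²`, for `w = 0` and `dw = 0` on the far wedge;
* `KerrSchild.timeTranslationEnergy_graph_eq` — for a **stationary** coefficient field
  (`∂_0 G = 0`) and a **solution** `□_G w = 0`, the `∂_0`-flux through the graph of `τ + F₂`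
  equals that through the graph of `τ + F₁` (conservation of the `T`-energy, `K^T = 0`,
  `𝓔^T = 0`; DRSR §2.3.2–§2.3.3).

With the raised index `(J^X)^μ = T^μ{}_ν X^ν` the *energy* through a graph is
`−∑_μ (J^X)^μ n_μ` (non-negative for future timelike `X` and spacelike graphs,
cf. `Kerr.graphFluxDensity`), so the graph identity is (ingeneralform) as printed:
`E_X[S⁺] + ∫_𝓑 (K^X + (□_g w) X(w)) = E_X[S⁻]` with `S⁻ = {t = τ + F₁}`, `S⁺ = {t = τ + F₂}`.

## References

* M. Dafermos, I. Rodnianski, Y. Shlapentokh-Rothman, arXiv:1402.7034 = Ann. of Math. 183 (2016),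
  §2.3.1–§2.3.2 (key `DafermosRodnianskiShlapentokhrothman2014`).
* M. Dafermos, I. Rodnianski, *Lectures on black holes and linear waves*, arXiv:0811.0354, App. D
  (key `DafermosRodnianski2008`).
-/

noncomputable section

open Set Filter
open scoped ContDiff Topology

namespace Literature.Geometry.Lorentzian

open _root_.MeasureTheory Metric

namespace KerrSchild

/-! ### Regularity of the currents -/

/-- A coordinate partial derivative of a `C²` function is `C¹`. [folklore] -/
theorem contDiff_fderiv_apply_basisVector {w : E4 → ℝ} (hw : ContDiff ℝ 2 w) (κ : Fin 4) :
    ContDiff ℝ 1 fun x ↦ fderiv ℝ w x (E4.basisVector κ) :=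
  (hw.fderiv_right (m := 1) le_rfl).clm_apply contDiff_const

/-- **The multiplier current of `C¹` coefficients, a `C¹` multiplier and a `C²` function is `C¹`.**
[folklore] -/
theorem contDiff_multiplierCurrent {G : E4 → Fin 4 → Fin 4 → ℝ} {X : E4 → Fin 4 → ℝ}
    {w : E4 → ℝ} (hG : ∀ μ ν, ContDiff ℝ 1 fun x ↦ G x μ ν) (hX : ∀ α, ContDiff ℝ 1 fun x ↦ X x α)
    (hw : ContDiff ℝ 2 w) (μ : Fin 4) : ContDiff ℝ 1 fun x ↦ multiplierCurrent G X w x μ := by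
  have hp := contDiff_fderiv_apply_basisVector hw
  unfold multiplierCurrent
  exact ((ContDiff.sum fun ν _ ↦ (hG μ ν).mul (hp ν)).mul
    (ContDiff.sum fun α _ ↦ (hX α).mul (hp α))).sub
      ((contDiff_const.mul (hX μ)).mul
        (ContDiff.sum fun α _ ↦ ContDiff.sum fun β _ ↦ ((hG α β).mul (hp α)).mul (hp β)))

/-- **The Lagrangian current of `C¹` coefficients and `C²` weight and function is `C¹`.**
[folklore] -/
theorem contDiff_lagrangianCurrent {G : E4 → Fin 4 → Fin 4 → ℝ} {ϖ w : E4 → ℝ}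
    (hG : ∀ μ ν, ContDiff ℝ 1 fun x ↦ G x μ ν) (hϖ : ContDiff ℝ 2 ϖ) (hw : ContDiff ℝ 2 w)
    (μ : Fin 4) : ContDiff ℝ 1 fun x ↦ lagrangianCurrent G ϖ w x μ := by
  have hp := contDiff_fderiv_apply_basisVector hw
  have hq := contDiff_fderiv_apply_basisVector hϖ
  have hw1 : ContDiff ℝ 1 w := hw.of_le one_le_two
  have hϖ1 : ContDiff ℝ 1 ϖ := hϖ.of_le one_le_two
  unfold lagrangianCurrent
  exact ((hϖ1.mul hw1).mul (ContDiff.sum fun ν _ ↦ (hG μ ν).mul (hp ν))).sub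
    ((contDiff_const.mul (hw1.pow 2)).mul (ContDiff.sum fun ν _ ↦ (hG μ ν).mul (hq ν)))

/-! ### The energy identity on slabs -/

/-- **The `X`-energy identity on a slab** (DRSR arXiv:1402.7034, §2.3.2, (ingeneralform) with
`S^± = {t = t^±}`, in the Kerr–Schild chart). Let `G` be a `C¹` symmetric coefficient field, `X` a
`C¹` multiplier, `w ∈ C²(ℝ⁴)` with `dw = 0` at the points `(t, y)`, `t₀ ≤ t ≤ t₁`, `‖y‖ > ρ`. Then
`∫ (J^X)⁰(t₁, y) dy − ∫ (J^X)⁰(t₀, y) dy = ∫_{(t₀, t₁]} ∫ ((□_G w) X(w) + K^X)(t, y) dy dt`.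
[cite: DafermosRodnianskiShlapentokhrothman2014, §2.3.2] -/
theorem multiplierCurrent_slab_identity {G : E4 → Fin 4 → Fin 4 → ℝ} {X : E4 → Fin 4 → ℝ}
    {w : E4 → ℝ} (hG : ∀ μ ν, ContDiff ℝ 1 fun x ↦ G x μ ν) (hsymm : ∀ x μ ν, G x μ ν = G x ν μ)
    (hX : ∀ α, ContDiff ℝ 1 fun x ↦ X x α) (hw : ContDiff ℝ 2 w) {ρ t₀ t₁ : ℝ} (h01 : t₀ ≤ t₁)
    (hfar : ∀ t ∈ Set.Icc t₀ t₁, ∀ y : E3, ρ < ‖y‖ → fderiv ℝ w (E4.ofTimeSpace t y) = 0) :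
    (∫ y, multiplierCurrent G X w (E4.ofTimeSpace t₁ y) 0) -
        ∫ y, multiplierCurrent G X w (E4.ofTimeSpace t₀ y) 0 =
      ∫ t in Set.Ioc t₀ t₁, ∫ y,
        (waveOperator G w (E4.ofTimeSpace t y) *
            (∑ α, X (E4.ofTimeSpace t y) α * fderiv ℝ w (E4.ofTimeSpace t y) (E4.basisVector α)) +
          multiplierBulk G X w (E4.ofTimeSpace t y)) := by
  have h := E4.integral_sub_eq_integral_divergence (J := fun μ x ↦ multiplierCurrent G X w x μ)
    (contDiff_multiplierCurrent hG hX hw) h01 (ρ := ρ) fun μ t ht y hy ↦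
      multiplierCurrent_eq_zero_of_fderiv_eq_zero G X (hfar t ht y hy) μ
  rw [h]
  refine setIntegral_congr_fun measurableSet_Ioc fun t _ ↦ ?_
  refine congrArg (fun f : E3 → ℝ ↦ ∫ y, f y) (funext fun y ↦ ?_)
  exact sum_fderiv_multiplierCurrent (fun μ ν ↦ ((hG μ ν).differentiable one_ne_zero).differentiableAt)
    (hsymm _) (fun α ↦ ((hX α).differentiable one_ne_zero).differentiableAt) hw.contDiffAt

/-! ### The energy identity between graph hypersurfaces -/

/-- **The `X`-energy identity between two graph hypersurfaces** (DRSR arXiv:1402.7034, §2.3.2,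
(ingeneralform), in the Kerr–Schild chart, `n^F = dt − dF`). Let `G` be a `C¹` symmetric
coefficient field, `X` a `C¹` multiplier, `F₁ ≤ F₂` two `C²` heights, `τ ∈ ℝ`, and `w ∈ C²(ℝ⁴)` with
`dw = 0` at the points `(t, y)` of the closed wedge `τ + F₁(y) ≤ t ≤ τ + F₂(y)` with `‖y‖ > ρ`.
Then
`∫ ∑_μ (J^X)^μ(τ + F₂(y), y) n^{F₂}_μ dy − ∫ ∑_μ (J^X)^μ(τ + F₁(y), y) n^{F₁}_μ dy
  = ∫ ∫_{(τ + F₁(y), τ + F₂(y)]} ((□_G w) X(w) + K^X)(t, y) dt dy`.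
[cite: DafermosRodnianskiShlapentokhrothman2014, §2.3.2] -/
theorem multiplierCurrent_graph_identity {G : E4 → Fin 4 → Fin 4 → ℝ} {X : E4 → Fin 4 → ℝ}
    {w : E4 → ℝ} (hG : ∀ μ ν, ContDiff ℝ 1 fun x ↦ G x μ ν) (hsymm : ∀ x μ ν, G x μ ν = G x ν μ)
    (hX : ∀ α, ContDiff ℝ 1 fun x ↦ X x α) (hw : ContDiff ℝ 2 w) {F₁ F₂ : E3 → ℝ}
    (hF₁ : ContDiff ℝ 2 F₁) (hF₂ : ContDiff ℝ 2 F₂) (hle : ∀ y, F₁ y ≤ F₂ y) {τ ρ : ℝ}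
    (hfar : ∀ x : E4, ρ < E4.spatialNorm x → τ + F₁ (E4.spatial x) ≤ x 0 →
      x 0 ≤ τ + F₂ (E4.spatial x) → fderiv ℝ w x = 0) :
    (∫ y, ∑ μ, multiplierCurrent G X w (E4.ofTimeSpace (τ + F₂ y) y) μ *
        Kerr.graphConormal F₂ y μ) -
        ∫ y, ∑ μ, multiplierCurrent G X w (E4.ofTimeSpace (τ + F₁ y) y) μ *
          Kerr.graphConormal F₁ y μ =
      ∫ y, ∫ t in Set.Ioc (τ + F₁ y) (τ + F₂ y),
        (waveOperator G w (E4.ofTimeSpace t y) *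
            (∑ α, X (E4.ofTimeSpace t y) α * fderiv ℝ w (E4.ofTimeSpace t y) (E4.basisVector α)) +
          multiplierBulk G X w (E4.ofTimeSpace t y)) := by
  have h := E4.graphFlux_sub_eq_integral_integral (J := fun μ x ↦ multiplierCurrent G X w x μ)
    (contDiff_multiplierCurrent hG hX hw) hF₁ hF₂ hle (τ := τ) (ρ := ρ) fun μ x hx h1 h2 ↦
      multiplierCurrent_eq_zero_of_fderiv_eq_zero G X (hfar x hx h1 h2) μ
  rw [h]
  refine congrArg (fun f : E3 → ℝ ↦ ∫ y, f y) (funext fun y ↦ ?_)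
  refine setIntegral_congr_fun measurableSet_Ioc fun t _ ↦ ?_
  exact sum_fderiv_multiplierCurrent (fun μ ν ↦ ((hG μ ν).differentiable one_ne_zero).differentiableAt)
    (hsymm _) (fun α ↦ ((hX α).differentiable one_ne_zero).differentiableAt) hw.contDiffAt

/-- **The energy identity for the modified current `J^{X,ϖ} = J^X + ¼ L` between two graph
hypersurfaces** (DRSR arXiv:1402.7034, §2.3.1–§2.3.2: "A similar identity holds for the
`J^{V,w}_μ` currents"). Hypotheses as in `multiplierCurrent_graph_identity`, with a `C²` weight
`ϖ` and `w = 0`, `dw = 0` on the far part of the closed wedge; the bulk is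
`(X(w) + ¼ ϖ w) □_G w + (K^X + ¼ ϖ Q − ⅛ (□_G ϖ) w²)` (`KerrSchild.sum_fderiv_modifiedCurrent`).
[cite: DafermosRodnianskiShlapentokhrothman2014, §2.3.2] -/
theorem modifiedCurrent_graph_identity {G : E4 → Fin 4 → Fin 4 → ℝ} {X : E4 → Fin 4 → ℝ}
    {ϖ w : E4 → ℝ} (hG : ∀ μ ν, ContDiff ℝ 1 fun x ↦ G x μ ν) (hsymm : ∀ x μ ν, G x μ ν = G x ν μ)
    (hX : ∀ α, ContDiff ℝ 1 fun x ↦ X x α) (hϖ : ContDiff ℝ 2 ϖ) (hw : ContDiff ℝ 2 w)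
    {F₁ F₂ : E3 → ℝ} (hF₁ : ContDiff ℝ 2 F₁) (hF₂ : ContDiff ℝ 2 F₂) (hle : ∀ y, F₁ y ≤ F₂ y)
    {τ ρ : ℝ}
    (hfar : ∀ x : E4, ρ < E4.spatialNorm x → τ + F₁ (E4.spatial x) ≤ x 0 →
      x 0 ≤ τ + F₂ (E4.spatial x) → w x = 0 ∧ fderiv ℝ w x = 0) :
    (∫ y, ∑ μ, (multiplierCurrent G X w (E4.ofTimeSpace (τ + F₂ y) y) μ +
        4⁻¹ * lagrangianCurrent G ϖ w (E4.ofTimeSpace (τ + F₂ y) y) μ) *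
          Kerr.graphConormal F₂ y μ) -
        ∫ y, ∑ μ, (multiplierCurrent G X w (E4.ofTimeSpace (τ + F₁ y) y) μ +
          4⁻¹ * lagrangianCurrent G ϖ w (E4.ofTimeSpace (τ + F₁ y) y) μ) *
            Kerr.graphConormal F₁ y μ =
      ∫ y, ∫ t in Set.Ioc (τ + F₁ y) (τ + F₂ y),
        (((∑ α, X (E4.ofTimeSpace t y) α * fderiv ℝ w (E4.ofTimeSpace t y) (E4.basisVector α)) +
              4⁻¹ * (ϖ (E4.ofTimeSpace t y) * w (E4.ofTimeSpace t y))) *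
            waveOperator G w (E4.ofTimeSpace t y) +
          (multiplierBulk G X w (E4.ofTimeSpace t y) +
            4⁻¹ * (ϖ (E4.ofTimeSpace t y) * ∑ α, ∑ β, G (E4.ofTimeSpace t y) α β *
              fderiv ℝ w (E4.ofTimeSpace t y) (E4.basisVector α) *
                fderiv ℝ w (E4.ofTimeSpace t y) (E4.basisVector β)) -
            8⁻¹ * waveOperator G ϖ (E4.ofTimeSpace t y) * w (E4.ofTimeSpace t y) ^ 2)) := by
  have hJ1 : ∀ μ, ContDiff ℝ 1 fun x ↦
      multiplierCurrent G X w x μ + 4⁻¹ * lagrangianCurrent G ϖ w x μ := fun μ ↦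
    (contDiff_multiplierCurrent hG hX hw μ).add
      (contDiff_const.mul (contDiff_lagrangianCurrent hG hϖ hw μ))
  have h := E4.graphFlux_sub_eq_integral_integral
    (J := fun μ x ↦ multiplierCurrent G X w x μ + 4⁻¹ * lagrangianCurrent G ϖ w x μ)
    hJ1 hF₁ hF₂ hle (τ := τ) (ρ := ρ) fun μ x hx h1 h2 ↦ by
      show multiplierCurrent G X w x μ + 4⁻¹ * lagrangianCurrent G ϖ w x μ = 0
      rw [multiplierCurrent_eq_zero_of_fderiv_eq_zero G X (hfar x hx h1 h2).2 μ,
        lagrangianCurrent_eq_zero_of_eq_zero G ϖ (hfar x hx h1 h2).1 μ, mul_zero, add_zero]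
  rw [h]
  refine congrArg (fun f : E3 → ℝ ↦ ∫ y, f y) (funext fun y ↦ ?_)
  refine setIntegral_congr_fun measurableSet_Ioc fun t _ ↦ ?_
  exact sum_fderiv_modifiedCurrent (fun μ ν ↦ ((hG μ ν).differentiable one_ne_zero).differentiableAt)
    (hsymm _) (fun α ↦ ((hX α).differentiable one_ne_zero).differentiableAt) hϖ.contDiffAt
    hw.contDiffAt

/-! ### Conservation of the `∂_0`-energy for stationary coefficients -/

/-- **Conservation of the `T`-energy between graph hypersurfaces** (DRSR arXiv:1402.7034,
§2.3.2–§2.3.3: for the Killing field `T`, `K^T = 0`, and `𝓔^T = 0` for solutions). Let `G` be a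
`C¹` symmetric coefficient field which is stationary, `∂_0 G^{αβ} = 0`, let `w ∈ C²(ℝ⁴)` solve
`□_G w = 0`, and let `F₁ ≤ F₂` be `C²` heights with `dw = 0` on the far part of the closed wedge
between the graphs of `τ + F₁`, `τ + F₂`. Then the `∂_0`-fluxes through the two graphs coincide:
`∫ ∑_μ (J^{∂_0})^μ(τ + F₂(y), y) n^{F₂}_μ dy = ∫ ∑_μ (J^{∂_0})^μ(τ + F₁(y), y) n^{F₁}_μ dy`.
(In Kerr the `J^T` flux through the horizon may be negative — superradiance, §2.3.3 — which is
why this conservation law alone does not bound the energy; here both hypersurfaces are graphs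
over all of `E3`.) [cite: DafermosRodnianskiShlapentokhrothman2014, §2.3.2] -/
theorem timeTranslationEnergy_graph_eq {G : E4 → Fin 4 → Fin 4 → ℝ} {w : E4 → ℝ}
    (hG : ∀ μ ν, ContDiff ℝ 1 fun x ↦ G x μ ν) (hsymm : ∀ x μ ν, G x μ ν = G x ν μ)
    (hstat : ∀ x α β, fderiv ℝ (fun y ↦ G y α β) x (E4.basisVector 0) = 0)
    (hw : ContDiff ℝ 2 w) (hsol : ∀ x, waveOperator G w x = 0) {F₁ F₂ : E3 → ℝ}
    (hF₁ : ContDiff ℝ 2 F₁) (hF₂ : ContDiff ℝ 2 F₂) (hle : ∀ y, F₁ y ≤ F₂ y) {τ ρ : ℝ}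
    (hfar : ∀ x : E4, ρ < E4.spatialNorm x → τ + F₁ (E4.spatial x) ≤ x 0 →
      x 0 ≤ τ + F₂ (E4.spatial x) → fderiv ℝ w x = 0) :
    (∫ y, ∑ μ, multiplierCurrent G (fun _ ν ↦ if ν = 0 then (1 : ℝ) else 0) w
        (E4.ofTimeSpace (τ + F₂ y) y) μ * Kerr.graphConormal F₂ y μ) =
      ∫ y, ∑ μ, multiplierCurrent G (fun _ ν ↦ if ν = 0 then (1 : ℝ) else 0) w
        (E4.ofTimeSpace (τ + F₁ y) y) μ * Kerr.graphConormal F₁ y μ := by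
  have hX : ∀ α : Fin 4, ContDiff ℝ 1 fun _ : E4 ↦ (if α = 0 then (1 : ℝ) else 0) :=
    fun α ↦ contDiff_const
  have h := E4.graphFlux_sub_eq_integral_integral
    (J := fun μ x ↦ multiplierCurrent G (fun _ ν ↦ if ν = 0 then (1 : ℝ) else 0) w x μ)
    (contDiff_multiplierCurrent hG hX hw) hF₁ hF₂ hle (τ := τ) (ρ := ρ) fun μ x hx h1 h2 ↦
      multiplierCurrent_eq_zero_of_fderiv_eq_zero G _ (hfar x hx h1 h2) μ
  have hdiv : ∀ x, ∑ μ, fderiv ℝ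
      (fun y ↦ multiplierCurrent G (fun _ ν ↦ if ν = 0 then (1 : ℝ) else 0) w y μ) x
        (E4.basisVector μ) = 0 := by
    intro x
    rw [sum_fderiv_multiplierCurrent_timeTranslation
      (fun μ ν ↦ ((hG μ ν).differentiable one_ne_zero).differentiableAt) (hsymm x) (hstat x)
      hw.contDiffAt, hsol x, zero_mul]
  simp only [hdiv, integral_zero, sub_eq_zero] at h
  exact h

end KerrSchild

end Literature.Geometry.Lorentzian
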